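import Summits.BirchSwinnertonDyer.Rank1Residual.ManinAdditive.ALTateCohomology
import HarnessLib
import HarnessLib.Audit.Tags

/-!
# LOCALIZATION OF THE TATE COHOMOLOGY OF `w_Q` TO ITS FIXED POINTS MOD 2: THEOREM A IN FULL (E-desc-83), THE INERT-VANISHING THEOREM V
# (E-desc-78), `T₂ = FROBENIUS` ON THE BRANCH SCHEME (E-desc-79/80/81) AND THE SLACK-ONE DIHEDRAL THEOREM D (E-desc-82) — typed
# (desc g13, MEMO-desc §30; cell `bsd-f2-manin`, T-desc-17, typer g15)

HONEST FRAMING.  LENS = descent / visibility (`bsd-f2-manin-desc` g13, MEMO-desc §30, «LANDED» 2026-08-28T21:46:33Z, SUPPLEMENT §30.13 21:54:36Z).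
SOURCE = HOME/desc/g13/Sketch-desc-g13.lean sha16 00b7755e588ea4e7 (275 l.; farm rc 0 per desc), VERBATIM except: namespace
`…ManinAdditive.DescG13` ↦ `…ManinAdditive.ALTateLocalization`; the five helpers shared with the g12 leaf (`reducedFormCount`, `wZ`,
`tateOrder`, `tateH0Order`, `tateH1Order`) are NOT re-declared but IMPORTED from `ALTateCohomology.lean` (T-desc-16, p671440) as desc asked;
this header replaces the sketch's (its mechanism paragraph is kept below).  NEW helpers: `heckeZ` (`T_ℓ` over `ℤ`), `alSignDim`
(`g^ε = dim S₂(N)^{w_Q = ε}`).  NOTHING IS ASSERTED: six `@[conjecture]` obligation nodes; `map_sub_le_alEigenLattice` and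
`two_smul_mem_map_sub` are SORRY-FREE sanity lemmas (the typed statements are genuine 2-primary statements).  NOT IN THIS FILE: the
§30.13 rows E-desc-84/85/86 (Brandt-at-2 / inert CM structure) — no Lean text in the sketch; they land when desc types them.

SET-UP (MEMO §30.1).  `N` odd, `p ∣ N`, `Q = p^{v_p(N)}` (ANY `v ≥ 1`: the multiplicative case `v = 1` and `Q = 3` are included), `w = w_Q`,
`S = S₂(Γ₀(N);ℤ)`, `L_Q = S ∩ w⁻¹S` (`alCutLattice N p`; `L_Q ⊗ ℤ₂ = S ⊗ ℤ₂ = H⁰(X₀(N)_{ℤ₂}, Ω)`), `S^± = S ∩ ker(w ∓ 1)`,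
`Ĥ⁰ = S⁺/(1+w)L_Q ≅ 𝔽₂^{t₊}`, `H¹ = S⁻/(w−1)L_Q ≅ 𝔽₂^{t₋}`, `g^± = dim_ℂ S₂(N)^{w = ±1}`, `ν = #Fix(w_Q | X₀(N)(ℂ)) = 2g + 2 − 4g⁺`,
`K = ℚ(√−Q)`.  THE MECHANISM (desc, MEMO §30.2–30.4, proved on paper): (L) LOCALIZATION `Ĥ^i(C₂, RΓ(X, O)) = ⊕_{y ∈ Fix(w̄)} Ĥ^i(C₂, Ô_{X,y})`
(free action off the fixed points); (F) LOCAL RINGS `Ĥ⁰(C₂, Ô_y) = k[y]/(y^{d_y/2})`, `Ĥ¹ = 0`, `Σ_y d_y = ν`; (D) duality gives the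
Hecke-equivariant exact sequence `0 → Ĥ⁰(C₂, M)^∨ → 𝔽₂ → O(B′) → H¹(C₂, M)^∨ → 0`, `O(B′) = ⊕_y k[y]/(y^{d_y/2})` (half branch scheme,
`deg B′ = ν/2`); (H) HECKE: `T_ℓ` (`ℓ ∤ 2N`) factors through the fixed points of `w_Q` on `X₀(Nℓ)`, `T₂ =` Frobenius on `O(B′_k)`.

ROWS (desc's text abridged; E-blind PRE-REGISTERED censuses desc/g13/PREREG.txt 1aad1523244b1ac3, engines eig_ms_h3.py / predict_g13.py
f10aed920c6f0468, second engine Brandt module at 2 (MEMO §30.11); CANDIDATES b433e27cbca0d705):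
* **E-desc-83 `ALTateRiemannHurwitzLaw`** — THEOREM A IN FULL (paper): `(t₊, t₋) = ([g⁺ = g⁻ + 1], max(g⁻ − g⁺, 0))` for every `Q ∥ N`,
  `N` odd; 100/100 cells (51 odd levels ≤ 501, 53 multiplicative) — supersedes E-desc-71/75 of `ALTateCohomology` (there `Q ≥ 5` / via `ν`).
* **E-desc-78 `ALTateInertHeckeVanishing`** — THEOREM V (paper): `T_ℓ = 0` on `H¹` and `Ĥ⁰` for odd `ℓ ∤ N` inert in `K`; 444/444 —
  upgrades E-desc-73 (nilpotent ↦ zero) and makes E-desc-74 a theorem.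
* **E-desc-79 `ALTateT2SplitOrderLaw`** (ORD `Q ≡ 7 (8)`: `T₂^{h(−Q)} = 1` on `H¹`; 16/16), **E-desc-80 `ALTateT2RamifiedInvolutionLaw`**
  (RAM `Q ≡ 1 (4)` or `Q = 3`: `T₂² = 1`; 18/18 + 12/12), **E-desc-81 `ALTateT2InertCubicLaw`** (INERT `Q ≡ 3 (8)`, `Q > 3`: `T₂³ = T₂`;
  7/7) — THEOREM F + the branch-structure lemma (supersingular injectivity step referee-flagged ⇒ LAWS).
* **E-desc-82 `ALSlackOneDihedral`** — THEOREM D (paper): slack one at a `w_Q`-minus optimal newform of odd level ⟹ `E(ℚ)[2] ≠ 0` or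
  `ℚ(√Δ_E) = ℚ(√−Q)`; = E-desc-74 with `Q ≥ 5` removed; 6/6 + multiplicative incidences §30.7.
NOT IN PRINT (desc placements MEMO-desc §30 / §29.7): the fixed-point counts are Ogg 1974 / Kluit / Furumoto–Hasegawa, the CM/Heegner
language Gross 1987 / Gross–Zagier 1986 §II.1, Serre–Tate canonical lifts; the Tate-cohomology theorems A/E/V/F/D for `S₂(Γ₀(N);ℤ)` are the
cell's (each row cites its nearest print BY NAME, shape only).  REFUTER VERDICTS: REF1 R-desc-18 (a)–(f) PENDING at filing (by-name BC7 on
these names requested); REF1 §R88-lite covered the g12 rows only; a finding is repaired under a NEW name (append-only).  REF2 placement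
pending.  bears_on: stmt-BirchSwinnertonDyer-22967 (the `2`-part of `c_E` via the two-cusp lattice at `2`, desc lens; no route binder consumes
these rows yet).  PARTITION 0 / ladder-live · beyond-print theorem: desc says YES on paper (A in full, E, V, F, D) — in Lean all six are
OPEN obligation nodes · BSD is not proved by this; Manin's conjecture is not proved by this.
-/

noncomputable section

open scoped MatrixGroups ModularForm

open CongruenceSubgroup WeierstrassCurve Literature.NumberTheory.EllipticCurves.ModularForms
  Literature.NumberTheory.DiophantineGeometry

namespace Summit.BirchSwinnertonDyer.Rank1Residual.ManinAdditive.ALTateLocalization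

open ALSignCongruence ALTateCohomology

/-! ### The Tate cohomology of `⟨w_Q⟩` on the two-cusp lattice (orders), the `w_Q`-character of `S₂(N)`, Hecke operators over `ℤ` -/

section Tate

variable {N : ℕ} [NeZero N]

variable (N) in
/-- `T_ℓ` as a `ℤ`-linear map. -/
abbrev heckeZ (ℓ : ℕ) [NeZero ℓ] : CuspForm (Gamma0 N) 2 →ₗ[ℤ] CuspForm (Gamma0 N) 2 :=
  (heckeT (Gamma0 N) 2 ℓ).restrictScalars ℤ

variable (N) in
/-- `g^{ε} = dim_ℂ S₂(Γ₀(N))^{w_{Q_p} = ε}`. -/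
def alSignDim (p : ℕ) (ε : ℂ) : ℕ :=
  Module.finrank ℂ (LinearMap.ker (atkinLehnerInvolutionAt N 2 p - ε • LinearMap.id))

end Tate

/-! ### THEOREM A in full (E-desc-83) -/

/-- **E-desc-83 `ALTateRiemannHurwitzLaw` — THEOREM A IN FULL (THEOREM ON PAPER, MEMO-desc §30.3).**  For odd `N` and ANY prime `p ∣ N`
(`Q = p^{v_p(N)}`, `v ≥ 1`): with `g^± = dim S₂(N)^{w_Q = ±1}` one has `#Ĥ⁰(⟨w_Q⟩, L_Q) = 2^{[g⁺ = g⁻ + 1]}` and `#H¹(⟨w_Q⟩, L_Q) = 2^{max(g⁻ − g⁺, 0)}`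
(`= 2^{[ν = 0]}`, `2^{max(ν/2 − 1, 0)}` with `ν = #Fix(w_Q) = 2g + 2 − 4g⁺` by Riemann–Hurwitz; `g⁺ − g⁻ ≤ 1` always).  Proof: the exact
sequence `0 → (Ĥ⁰)^∨ → 𝔽₂ → O(B′) → (H¹)^∨ → 0` of the module docstring (`deg B′ = ν/2`) gives `t₊ = [ν = 0]`, `t₋ = deg B′ − [ν > 0]`.
E-blind census: 100/100 cells at 51 odd levels `N ≤ 501` (47 free, 53 with fixed points; 53 multiplicative `Q = p`, 12 with `Q = 3`).
Why it might fail: only through a mis-typing (`relIndex` conventions); the mathematics is a theorem.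
[cite: Ogg1974, Prop. 3 and p. 454 (shape only: `g⁺` and the fixed points of `w_Q` via class numbers; the Tate-cohomology statement is the cell's E-desc-83 — desc MEMO-desc §30)] -/
@[conjecture]
def ALTateRiemannHurwitzLaw : Prop :=
  ∀ (N : ℕ) [NeZero N] (p : ℕ), p.Prime → p ∣ N → ¬ 2 ∣ N →
    (tateH0Order N p = if alSignDim N p 1 = alSignDim N p (-1) + 1 then 2 else 1) ∧
      tateH1Order N p = 2 ^ (alSignDim N p (-1) - alSignDim N p 1)

/-! ### THEOREM V — inert Hecke operators vanish on the Tate cohomology (E-desc-78) -/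

/-- **E-desc-78 `ALTateInertHeckeVanishing` — THEOREM V (THEOREM ON PAPER, MEMO-desc §30.4).**  For odd `N`, a prime `p ∣ N` with
`Q = p^{v_p(N)}` (any `v ≥ 1`), and an odd prime `ℓ ∤ N` with `(−Q/ℓ) = −1` (i.e. `ℓ` inert in `K = ℚ(√−Q)`):
**`T_ℓ S⁻ ⊆ (w_Q − 1)L_Q`, i.e. `T_ℓ = 0` on `H¹(⟨w_Q⟩, L_Q)`** (and `T_ℓ S⁺ ⊆ (w_Q + 1)L_Q` likewise).  Proof: `T_ℓ` on
`Ĥ^*(C₂, RΓ(X₀(N)_{W}, O))` factors through `Ĥ^*(C₂, RΓ(X₀(Nℓ)_{W}, O))`, which localizes on the fixed points of `w_Q` on `X₀(Nℓ)_{𝔽̄₂}`;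
there are none: every fixed point of `w_Q` on `X₀(Nℓ)` is a CM point by an order of `K` carrying a `w_Q`-compatible `Γ₀(ℓ)`-structure, of
which there are `1 + (disc/ℓ) = 0`, and fixed points mod 2 are specialisations of geometric generic ones (local computation (F)).  The exact
sequence `𝔽₂ → O(B′) → (H¹)^∨ → 0` is `T_ℓ`-equivariant, so `T_ℓ = 0` on `(H¹)^∨`, on `H¹`, and dually on `Ĥ⁰`.  UPGRADES E-desc-73
(`T_ℓ` nilpotent, `Q ≥ 5`) to `T_ℓ = 0`, all `Q`.  E-blind census: 444/444 (cell, inert odd `ℓ ≤ 60`) pairs over the 53 fixed-point cells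
(ORD 16, RAM 18, INERT 7, `Q = 3` 12), `rank(T_ℓ | H¹) = 0` in every one.  Why it might fail: none on paper; typed risk = the integral
inclusion is equivalent to the `ℤ₂`-statement because `S⁻/(w − 1)L_Q` is 2-torsion (`2x = (w − 1)(−x)`).
[cite: GrossZagier1986, §II.1 (shape only: Heegner/CM points with cyclic level structure ↔ ideals of norm `ℓ`, none at inert `ℓ`; the vanishing theorem is the cell's E-desc-78 — desc MEMO-desc §30)] -/
@[conjecture]
def ALTateInertHeckeVanishing : Prop :=
  ∀ (N : ℕ) [NeZero N] (p ℓ : ℕ) [NeZero ℓ], p.Prime → p ∣ N → ¬ 2 ∣ N → ℓ.Prime → ¬ ℓ ∣ N → ℓ ≠ 2 →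
    jacobiSym (-((p ^ N.factorization p : ℕ) : ℤ)) ℓ = -1 →
    (∀ x ∈ alEigenLattice N p (-1), heckeZ N ℓ x ∈ (alCutLattice N p).map (wZ N p - LinearMap.id)) ∧
      ∀ x ∈ alEigenLattice N p 1, heckeZ N ℓ x ∈ (alCutLattice N p).map (wZ N p + LinearMap.id)

/-! ### `T₂ = FROBENIUS` on the half branch scheme: the three CM regimes at 2 (E-desc-79/80/81) -/

/-- **E-desc-79 `ALTateT2SplitOrderLaw` — THEOREM F + branch lemma, ORDINARY case (MEMO-desc §30.5/30.6; THEOREM ON PAPER modulo the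
étaleness of the degeneracy maps at the canonical points, LAW by census).**  For odd `N`, `p ∣ N` with `Q = p^{v_p(N)} ≡ 7 (mod 8)` (so `v` is
odd, `p ≡ 7 (8)`, `2` splits in `K = ℚ(√−p)`, the fixed points have ORDINARY reduction): `T₂` acts on `H¹(⟨w_Q⟩, L_Q)` as the permutation
`σ_{𝔭₂}` of `Pic(O_{−Q})` acting on `O(B′)/𝔽₂ = 𝔽₂[Heeg_N(O_{−Q}) mod 2]/𝔽₂·𝟙` (`B′` is reduced: each canonical-lift fixed point
collides mod 2 exactly with its conductor-2 quasi-canonical partner from `Heeg_N(O_{−4Q})`; Serre–Tate), so `T₂` has multiplicative order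
EXACTLY `n₂ = ord_{Pic(O_{−Q})}[𝔭₂]` (odd, divides `h(−Q)`); typed consequence: **`T₂^{h(−Q)} ≡ 1` on `H¹`**.  E-blind pre-registered
census 16/16 cells: `n₂ = 1` at `Q = 7` (N = 77, 161, 203, 371; `T₂ = 1`), `3` at `Q = 23` (69, 207, 299) and `Q = 31` (155, 217), `5` at
`Q = 47` (141, 329) and `Q = 79` (395), `7` at `Q = 71` (213, 355) and `Q = 343` (343), `11` at `Q = 167` (501: `T₂` of order 11 on `𝔽₂^{21}`,
charpoly `(x+1)·Φ₁₁(x)²`); second engine (Brandt module at 2, MEMO-desc §30.11): NO `w_Q`-fixed supersingular point in any of the 16 cells.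
Why it might fail: a level where two canonical points with different orientations collide mod 2 (would need `j`-invariants of distinct
ordinary CM classes to agree mod `𝔭₂` — excluded by Serre–Tate, so only through the orientation count at `ℓ′ ∣ N/Q` with `ℓ′² ∣ N`).
[cite: Gross1987, §3 (shape only: Hecke/Galois action on Heegner points through `Pic(O)`; the `T₂`-order statement is the cell's E-desc-79 — desc MEMO-desc §30)] -/
@[conjecture]
def ALTateT2SplitOrderLaw : Prop :=
  ∀ (N : ℕ) [NeZero N] (p : ℕ), p.Prime → p ∣ N → ¬ 2 ∣ N → p ^ N.factorization p % 8 = 7 →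
    ∀ x ∈ alEigenLattice N p (-1),
      ((heckeZ N 2) ^ reducedFormCount (-((p ^ N.factorization p : ℕ) : ℤ))) x - x ∈
        (alCutLattice N p).map (wZ N p - LinearMap.id)

/-- **E-desc-80 `ALTateT2RamifiedInvolutionLaw` — LAW T2-RAM (MEMO-desc §30.5/30.6).**  For odd `N`, `p ∣ N` with `Q = p^{v_p(N)} ≡ 1 (mod 4)`
(`2` ramified in `K`: `v` even or `p ≡ 1 (4)`) OR `Q = 3`: **`T₂² ≡ 1` on `H¹(⟨w_Q⟩, L_Q)`** (`T₂` is a unipotent involution: `B′` is reduced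
of degree `ν/2`, Frobenius acts on `B′_red = ρ(Heeg_N(O_{−4Q}))` through `σ_𝔭`, `𝔭² = (2)`; at `Q = 3` the unit index `[ℤ[ζ₃]^× : O₂^×] = 3`
makes the three children of a parent coincide, so `B′` is again reduced and `F` is a reflection).  `T₂ = 1` exactly iff `F` fixes `B′_red`
pointwise (8/18 RAM cells, 10/12 `Q = 3` cells — information, not law).  E-blind pre-registered census: RAM 18/18 ((45,5), (115,5), (145,5),
(205,5), (235,5), (45,9), (117,9), (153,9), (51,17), (119,17), (153,17), (87,29), (145,29), (123,41), (205,41), (287,41), (81,81), (125,125)),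
`Q = 3` 12/12 ((21,3), (39,3), (57,3), (93,3), (111,3), (129,3), (183,3), (201,3), (219,3), (237,3), (273,3), (399,3)); second engine (MEMO-desc
§30.11): `#SS_N^{w_Q} = ν/2` in all 30 cells and `charpoly(F̂ ∣ 𝔽₂[SS_N^{w_Q}]) = (x+1)·charpoly(T₂ ∣ H¹)` 30/30.  Why it might fail: a RAM level where a fixed point has `d_y ≥ 4` (three Heegner points of discriminant
`−4Q` colliding mod 2), which the census cannot exclude beyond `N ≤ 501`.
[cite: GrossZagier1986, §II.1 (shape only: CM points and their reduction; the involution law is the cell's E-desc-80 — desc MEMO-desc §30)] -/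
@[conjecture]
def ALTateT2RamifiedInvolutionLaw : Prop :=
  ∀ (N : ℕ) [NeZero N] (p : ℕ), p.Prime → p ∣ N → ¬ 2 ∣ N →
    (p ^ N.factorization p % 4 = 1 ∨ p ^ N.factorization p = 3) →
    ∀ x ∈ alEigenLattice N p (-1),
      ((heckeZ N 2) ^ 2) x - x ∈ (alCutLattice N p).map (wZ N p - LinearMap.id)

/-- **E-desc-81 `ALTateT2InertCubicLaw` — LAW T2-INERT (MEMO-desc §30.5/30.6).**  For odd `N`, `p ∣ N` with `Q = p^{v_p(N)} ≡ 3 (mod 8)`,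
`Q > 3` (`2` inert in `K = ℚ(√−p)`, supersingular reduction, unit index 1): **`T₂³ ≡ T₂` on `H¹(⟨w_Q⟩, L_Q)`**, and (not typed) `T₂` is NOT
invertible, `rank(T₂ | H¹) = ν/4 − 1`, `charpoly = x^{ν/4}(x+1)^{ν/4−1}`: the half branch scheme is `⊕_{y ∈ B′_red} k[u]/(u²)` with
`B′_red = ρ(Heeg_N(O_K))` (`|B′_red| = ν/4`; over each parent `x` lie `x` and the three conductor-2 children of `F(x)`, `d_y = 4`), and Frobenius
kills `u` and permutes `B′_red` by a reflection (`F² = Frob_{(2)} = 1` in `Gal(H/K)`).  E-blind pre-registered census 7/7 ((33,11), (55,11), (95,19),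
(177,59), (253,11), (413,59), (243,243): every cell `cub = 1`, `ord = −1`, `rk = ν/4 − 1`); second engine (MEMO-desc §30.11): `#SS_N^{w_Q} = ν/4`
7/7 and the «old nilradical» law 90/90 + 15/15.  Why it might fail: a parent whose
reduction is not injective on `Heeg_N(O_K)` (supersingular `j = 0`: injectivity comes from the level structure only) would raise some `d_y` to 8
and break the rank formula, though not `T₂³ = T₂`.
[cite: Gross1987, §3 (shape only: supersingular reduction of Heegner points and the Hecke module they span; the cubic law is the cell's E-desc-81 — desc MEMO-desc §30)] -/
@[conjecture]
def ALTateT2InertCubicLaw : Prop :=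
  ∀ (N : ℕ) [NeZero N] (p : ℕ), p.Prime → p ∣ N → ¬ 2 ∣ N → p ^ N.factorization p % 8 = 3 → p ^ N.factorization p ≠ 3 →
    ∀ x ∈ alEigenLattice N p (-1),
      ((heckeZ N 2) ^ 3) x - heckeZ N 2 x ∈ (alCutLattice N p).map (wZ N p - LinearMap.id)

/-! ### THEOREM D — slack one at a minus sign is dihedral from `ℚ(√−Q)` (E-desc-82, E-facing) -/

/-- **E-desc-82 `ALSlackOneDihedral` — THEOREM D (THEOREM ON PAPER, MEMO-desc §30.7; = E-desc-74 with `Q ≥ 5` removed and a proof).**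
`E/ℚ` elliptic of ODD conductor `N`, `D` a modular parametrisation datum of level `N` (newform `f = D.f`), `p ∣ N` (`Q = p^{v_p(N)}`, any
`v ≥ 1`), `w_Q f = −f`, and two-cusp slack one at `Q`: `[e_f L_Q : ℤf] = [e_f S⁻ : ℤf]`.  Then `E(ℚ)[2] ≠ 0` or `−Q·Δ_E ∈ (ℚ^×)²`
(`ℚ(√Δ_E) = ℚ(√−Q)`).  Proof: slack one ⟹ the mod-2 `f`-functional factors through `H¹(⟨w_Q⟩, L_Q)` (PROP 28.9 / S-desc-g11′) ⟹ by
THEOREM V `a_ℓ(f) ≡ 0 (mod 2)` for every odd prime `ℓ ∤ N` inert in `K = ℚ(√−Q)` ⟹ `ρ̄_{E,2}(Frob_ℓ) ∈ GL₂(𝔽₂) ≅ S₃` has order `≤ 2` for all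
such `ℓ` ⟹ (Chebotarev; `K` and `ℚ(E[2])` are linearly disjoint unless `K ⊆ ℚ(E[2])`) the image is not `C₃` and, if it is `S₃`, its quadratic
subfield `ℚ(√Δ_E)` equals `K`.  Census (g12+g13 E-facing rows): 6/6 slack-one minus incidences at odd square level (121a1, 121c1: `ℚ(√−11)`;
27a1, 243b1: `ℚ(√−3)`; 45a1, 49a1: 2-torsion) — the multiplicative incidences of the g13 rows are listed in MEMO §30.7.  Why it might fail: only
through the typing of «slack one» by `lineIndex` (S-desc-g11′ (ii) is the bridge).
[cite: AgasheRibetStein2012, Prop. 2.3 (shape only: congruence number vs modular degree on the optimal line; the dihedral statement is the cell's E-desc-82 — desc MEMO-desc §30)] -/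
@[conjecture]
def ALSlackOneDihedral : Prop :=
  ∀ (W : WeierstrassCurve ℚ) [W.IsElliptic] [NeZero (W.conductorNorm ℤ)]
    (D : ModularParametrizationData W (W.conductorNorm ℤ)),
    ¬ 2 ∣ W.conductorNorm ℤ →
    ∀ p : ℕ, p.Prime → p ∣ W.conductorNorm ℤ →
      atkinLehnerInvolutionAt (W.conductorNorm ℤ) 2 p D.f = (-1 : ℂ) • D.f →
      lineIndex (alCutLattice (W.conductorNorm ℤ) p) D.f = lineIndex (alEigenLattice (W.conductorNorm ℤ) p (-1)) D.f →
      (∃ P : W.toAffine.Point, P ≠ 0 ∧ (2 : ℕ) • P = 0) ∨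
        IsSquare (-((p : ℚ) ^ (W.conductorNorm ℤ).factorization p) * W.Δ)

/-! ### Two proved sanity lemmas (the typed statements are not vacuous in the trivial direction) -/

section Sanity

variable {N : ℕ} [NeZero N]

/-- `(w − 1)L_Q ⊆ S⁻` — the target of THEOREM V is inside the source (so `T_ℓ = 0` on the quotient is a genuine 2-primary statement). -/
theorem map_sub_le_alEigenLattice (p : ℕ) (hw : ∀ x, atkinLehnerInvolutionAt N 2 p (atkinLehnerInvolutionAt N 2 p x) = x) :
    (alCutLattice N p).map (wZ N p - LinearMap.id) ≤ alEigenLattice N p (-1) := by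
  rintro _ ⟨x, hx, rfl⟩
  have hx' : x ∈ alCutLattice N p := hx
  rw [alCutLattice, Submodule.mem_inf, Submodule.mem_comap, LinearMap.restrictScalars_apply] at hx'
  obtain ⟨hxS, hwxS⟩ := hx'
  have e1 : (wZ N p - LinearMap.id : CuspForm (Gamma0 N) 2 →ₗ[ℤ] CuspForm (Gamma0 N) 2) x =
      atkinLehnerInvolutionAt N 2 p x - x := by
    simp only [LinearMap.sub_apply, LinearMap.id_apply, LinearMap.restrictScalars_apply]
  rw [e1, alEigenLattice, Submodule.mem_inf, LinearMap.mem_ker, LinearMap.sub_apply, LinearMap.smul_apply, LinearMap.id_apply,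
    LinearMap.restrictScalars_apply, map_sub, hw]
  refine ⟨sub_mem hwxS hxS, ?_⟩
  simp only [neg_smul, one_smul, sub_neg_eq_add]
  abel

/-- `2·S⁻ ⊆ (w − 1)L_Q`: the quotient `S⁻/(w − 1)L_Q = H¹(⟨w_Q⟩, L_Q)` is 2-torsion (so the integral statements of this file are
statements over `ℤ₂`, equivalently over `𝔽₂`). -/
theorem two_smul_mem_map_sub (p : ℕ) (x : CuspForm (Gamma0 N) 2) (hx : x ∈ alEigenLattice N p (-1)) :
    (2 : ℤ) • x ∈ (alCutLattice N p).map (wZ N p - LinearMap.id) := by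
  rw [alEigenLattice, Submodule.mem_inf, LinearMap.mem_ker, LinearMap.sub_apply, LinearMap.smul_apply, LinearMap.id_apply,
    LinearMap.restrictScalars_apply] at hx
  obtain ⟨hxS, hwx⟩ := hx
  have hwx' : atkinLehnerInvolutionAt N 2 p x = -x := by
    have := sub_eq_zero.mp hwx
    rw [this, neg_smul, one_smul]
  refine ⟨-x, ?_, ?_⟩
  · change -x ∈ alCutLattice N p
    rw [alCutLattice, Submodule.mem_inf, Submodule.mem_comap, LinearMap.restrictScalars_apply, map_neg, hwx', neg_neg]
    exact ⟨neg_mem hxS, hxS⟩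
  · simp only [LinearMap.sub_apply, LinearMap.id_apply, LinearMap.restrictScalars_apply, map_neg, hwx']
    rw [two_smul]; abel

end Sanity

end Summit.BirchSwinnertonDyer.Rank1Residual.ManinAdditive.ALTateLocalization

end
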